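import Summits.Ventures.CertifiedQuantumChemistry.Rows.HubbardRingKernelL8Tables
import HarnessLib

/-!
# Ventures/CertifiedQuantumChemistry — Rows/HubbardRingKernelL8Forms.lean: sliced kernel forms of the 8-ring, sector (4,4) — part 2 of the L = 8 kernel UPPER set

HONEST FRAMING (verbatim): certified bounds for a stated model Hamiltonian in a stated basis; not a
claim about the real molecule beyond that model.

var-2 (gen 19), zero compute. Continuation of `Rows/HubbardRingKernelL8Tables.lean`: the double-occupancy table check (`card_r8s4_inter`, 10 slices), the
entry point `ringL8_upperCertificate_of_trial` (the typer's generic `hubbardRingTV_upperCertificate_of_trial` at `L = 8`, sector dimension 4 900),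
§Adj — a generic ADJACENCY-LIST evaluation of the integer hopping form (`adjEval_eq_sum`; `AdjRep`, decidable; `hopZ_eq_hopZAdjSlices`,
`hopZAdjSlices_add`) with the adjacency check `r8K4adj_rep` (sliced) —, §DiagSlices — row slices of `dblZ` / `nsqZ` —, and the assembly lemmas
`hopZ_r8K4_adjSlices` / `dblZ_r8d44_slices` / `nsqZ_r8_slices` writing the three trial integers of any `70 × 70` array as sums of 10 kernel-evaluable
slices (used by `Certificates/HubbardRingSP1L8KernelUpperU{100,400}.lean`). Generic lemmas farm-tested in scratch before assembly. 0 `sorry`;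
the only new `Prop`-valued definition is the decidable bookkeeping predicate `AdjRep`.
-/


set_option linter.style.longLine false

namespace Summit.Ventures.CertifiedQuantumChemistry

open Matrix Finset
open Literature.MathematicalPhysics.QuantumLattice Literature.MathematicalPhysics.QuantumChemistry
open Literature.MathematicalPhysics.QuantumLattice.TwoSpecies
open Summit.Ventures.CertifiedQuantumChemistry.Hamiltonians
open Summit.HubbardSuperconductivity.HubbardSuperconductivity.Theorems.CooperPairDMottWalk
open scoped ComplexOrder

/-! ## §Adj — adjacency-list evaluation of the integer hopping form (generic) -/

section Adj

variable {p' q' : ℕ}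

/-- Coefficient of index `i'` in an adjacency list `l` (sum of the weights attached to `i'`). -/
def adjCoeff (l : List (Fin p' × ℤ)) (i' : Fin p') : ℤ := (l.map fun e => if e.1 = i' then e.2 else 0).sum

/-- Weighted evaluation of an adjacency list against a vector `g`: `Σ_{(i', w) ∈ l} w · g i'`. -/
def adjEval (l : List (Fin p' × ℤ)) (g : Fin p' → ℤ) : ℤ := (l.map fun e => e.2 * g e.1).sum

/-- A weighted list sum is the table sum with the list's coefficients. -/
theorem adjEval_eq_sum (l : List (Fin p' × ℤ)) (g : Fin p' → ℤ) :
    adjEval l g = ∑ i', adjCoeff l i' * g i' := by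
  induction l with
  | nil => simp [adjEval, adjCoeff]
  | cons a t ih =>
    simp only [adjEval, List.map_cons, List.sum_cons, adjCoeff] at ih ⊢
    rw [ih]
    rw [show (∑ i', ((if a.1 = i' then a.2 else 0) + (t.map fun e => if e.1 = i' then e.2 else 0).sum) * g i')
        = (∑ i', (if a.1 = i' then a.2 else 0) * g i') + ∑ i', (t.map fun e => if e.1 = i' then e.2 else 0).sum * g i' by
      rw [← Finset.sum_add_distrib]; exact Finset.sum_congr rfl fun _ _ => add_mul _ _ _]
    congr 1
    rw [Finset.sum_eq_single a.1 (fun b _ hb => by rw [if_neg (Ne.symm hb), zero_mul]) (fun h => absurd (Finset.mem_univ _) h), if_pos rfl]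

/-- An adjacency list `adj` REPRESENTS the table `K`: its coefficients are the table entries (decidable). -/
def AdjRep (adj : Fin p' → List (Fin p' × ℤ)) (K : Fin p' → Fin p' → ℤ) : Prop := ∀ i i', adjCoeff (adj i) i' = K i i'

/-- `AdjRep` is decidable (a finite conjunction of integer equalities). -/
instance (adj : Fin p' → List (Fin p' × ℤ)) (K : Fin p' → Fin p' → ℤ) : Decidable (AdjRep adj K) := by
  unfold AdjRep; infer_instance

/-- Row-`i` summand of `hopZ`, evaluated through adjacency lists. -/
def hopZAdjRow (adjA : Fin p' → List (Fin p' × ℤ)) (adjB : Fin q' → List (Fin q' × ℤ)) (v : Fin p' → Fin q' → ℤ) (i : Fin p') : ℤ :=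
  ∑ j, v i j * (adjEval (adjA i) (fun i' => v i' j) + adjEval (adjB j) (fun j' => v i j'))

/-- The same summand as a function of a natural row index (`0` beyond the last row). -/
def hopZAdjRowNat (adjA : Fin p' → List (Fin p' × ℤ)) (adjB : Fin q' → List (Fin q' × ℤ)) (v : Fin p' → Fin q' → ℤ) (t : ℕ) : ℤ :=
  if h : t < p' then hopZAdjRow adjA adjB v ⟨t, h⟩ else 0

/-- Partial row sums `Σ_{lo ≤ t < lo + len}` through adjacency lists (kernel-evaluable slice). -/
def hopZAdjSlices (adjA : Fin p' → List (Fin p' × ℤ)) (adjB : Fin q' → List (Fin q' × ℤ)) (v : Fin p' → Fin q' → ℤ) (lo len : ℕ) : ℤ :=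
  ∑ t ∈ range len, hopZAdjRowNat adjA adjB v (lo + t)

/-- Splitting a slice. -/
theorem hopZAdjSlices_add (adjA : Fin p' → List (Fin p' × ℤ)) (adjB : Fin q' → List (Fin q' × ℤ)) (v : Fin p' → Fin q' → ℤ) (lo a b : ℕ) :
    hopZAdjSlices adjA adjB v lo (a + b) = hopZAdjSlices adjA adjB v lo a + hopZAdjSlices adjA adjB v (lo + a) b := by
  induction b with
  | zero => simp [hopZAdjSlices]
  | succ b ih =>
    have h1 : hopZAdjSlices adjA adjB v lo (a + (b + 1)) = hopZAdjSlices adjA adjB v lo (a + b) + hopZAdjRowNat adjA adjB v (lo + (a + b)) := by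
      simp only [hopZAdjSlices, ← Nat.add_assoc a b 1, Finset.sum_range_succ]
    have h2 : hopZAdjSlices adjA adjB v (lo + a) (b + 1) = hopZAdjSlices adjA adjB v (lo + a) b + hopZAdjRowNat adjA adjB v (lo + a + b) := by
      simp only [hopZAdjSlices, Finset.sum_range_succ]
    rw [h1, h2, ih, Nat.add_assoc lo a b, add_assoc]

/-- `hopZ` through adjacency lists representing the tables: the full slice `[0, p)`. -/
theorem hopZ_eq_hopZAdjSlices {adjA : Fin p' → List (Fin p' × ℤ)} {adjB : Fin q' → List (Fin q' × ℤ)}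
    {Ka : Fin p' → Fin p' → ℤ} {Kb : Fin q' → Fin q' → ℤ} (hA : AdjRep adjA Ka) (hB : AdjRep adjB Kb)
    (v : Fin p' → Fin q' → ℤ) : hopZ Ka Kb v = hopZAdjSlices adjA adjB v 0 p' := by
  unfold hopZAdjSlices hopZ
  simp only [Nat.zero_add]
  rw [← Fin.sum_univ_eq_sum_range (hopZAdjRowNat adjA adjB v) p']
  refine Finset.sum_congr rfl fun i _ => ?_
  rw [hopZAdjRowNat, dif_pos i.isLt]
  show _ = hopZAdjRow adjA adjB v i
  unfold hopZAdjRow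
  refine Finset.sum_congr rfl fun j _ => ?_
  rw [adjEval_eq_sum, adjEval_eq_sum]
  simp only [hA i, hB j]

end Adj

/-! ## §DiagSlices — row slices of `dblZ` and `nsqZ` (generic) -/

section DiagSlices

variable {p' q' : ℕ}

/-- Row-`i` summand of `dblZ d v`. -/
def dblZRow (d : Fin p' → Fin q' → ℕ) (v : Fin p' → Fin q' → ℤ) (i : Fin p') : ℤ := ∑ j, (d i j : ℤ) * (v i j * v i j)

/-- The same as a function of a natural row index (`0` beyond the last row). -/
def dblZRowNat (d : Fin p' → Fin q' → ℕ) (v : Fin p' → Fin q' → ℤ) (t : ℕ) : ℤ :=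
  if h : t < p' then dblZRow d v ⟨t, h⟩ else 0

/-- Partial row sums of `dblZ` (kernel-evaluable slice). -/
def dblZSlices (d : Fin p' → Fin q' → ℕ) (v : Fin p' → Fin q' → ℤ) (lo len : ℕ) : ℤ :=
  ∑ t ∈ range len, dblZRowNat d v (lo + t)

/-- Splitting a `dblZ` slice. -/
theorem dblZSlices_add (d : Fin p' → Fin q' → ℕ) (v : Fin p' → Fin q' → ℤ) (lo a b : ℕ) :
    dblZSlices d v lo (a + b) = dblZSlices d v lo a + dblZSlices d v (lo + a) b := by
  induction b with
  | zero => simp [dblZSlices]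
  | succ b ih =>
    have h1 : dblZSlices d v lo (a + (b + 1)) = dblZSlices d v lo (a + b) + dblZRowNat d v (lo + (a + b)) := by
      simp only [dblZSlices, ← Nat.add_assoc a b 1, Finset.sum_range_succ]
    have h2 : dblZSlices d v (lo + a) (b + 1) = dblZSlices d v (lo + a) b + dblZRowNat d v (lo + a + b) := by
      simp only [dblZSlices, Finset.sum_range_succ]
    rw [h1, h2, ih, Nat.add_assoc lo a b, add_assoc]

/-- `dblZ` is the full slice `[0, p)`. -/
theorem dblZ_eq_dblZSlices (d : Fin p' → Fin q' → ℕ) (v : Fin p' → Fin q' → ℤ) : dblZ d v = dblZSlices d v 0 p' := by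
  unfold dblZSlices dblZ
  simp only [Nat.zero_add]
  rw [← Fin.sum_univ_eq_sum_range (dblZRowNat d v) p']
  refine Finset.sum_congr rfl fun i _ => ?_
  rw [dblZRowNat, dif_pos i.isLt]
  rfl

/-- Row-`i` summand of `nsqZ v`. -/
def nsqZRow (v : Fin p' → Fin q' → ℤ) (i : Fin p') : ℤ := ∑ j, v i j * v i j

/-- The same as a function of a natural row index. -/
def nsqZRowNat (v : Fin p' → Fin q' → ℤ) (t : ℕ) : ℤ := if h : t < p' then nsqZRow v ⟨t, h⟩ else 0

/-- Partial row sums of `nsqZ` (kernel-evaluable slice). -/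
def nsqZSlices (v : Fin p' → Fin q' → ℤ) (lo len : ℕ) : ℤ := ∑ t ∈ range len, nsqZRowNat v (lo + t)

/-- Splitting an `nsqZ` slice. -/
theorem nsqZSlices_add (v : Fin p' → Fin q' → ℤ) (lo a b : ℕ) :
    nsqZSlices v lo (a + b) = nsqZSlices v lo a + nsqZSlices v (lo + a) b := by
  induction b with
  | zero => simp [nsqZSlices]
  | succ b ih =>
    have h1 : nsqZSlices v lo (a + (b + 1)) = nsqZSlices v lo (a + b) + nsqZRowNat v (lo + (a + b)) := by
      simp only [nsqZSlices, ← Nat.add_assoc a b 1, Finset.sum_range_succ]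
    have h2 : nsqZSlices v (lo + a) (b + 1) = nsqZSlices v (lo + a) b + nsqZRowNat v (lo + a + b) := by
      simp only [nsqZSlices, Finset.sum_range_succ]
    rw [h1, h2, ih, Nat.add_assoc lo a b, add_assoc]

/-- `nsqZ` is the full slice `[0, p)`. -/
theorem nsqZ_eq_nsqZSlices (v : Fin p' → Fin q' → ℤ) : nsqZ v = nsqZSlices v 0 p' := by
  unfold nsqZSlices nsqZ
  simp only [Nat.zero_add]
  rw [← Fin.sum_univ_eq_sum_range (nsqZRowNat v) p']
  refine Finset.sum_congr rfl fun i _ => ?_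
  rw [nsqZRowNat, dif_pos i.isLt]
  rfl

end DiagSlices

/-! ## `L = 8` checks, entry point and slice assembly -/

section L8

set_option maxRecDepth 100000 in set_option maxHeartbeats 4000000 in
/-- Kernel check of the double-occupancy table, outer rows `0 ≤ i < 7` (slice 1 of 10). -/
theorem card_r8s4_inter_slice0 : ∀ i j : Fin 70, i.val < 7 → (r8s4 i ∩ r8s4 j).card = r8d44 i j := by
  decide +kernel

set_option maxRecDepth 100000 in set_option maxHeartbeats 4000000 in
/-- Kernel check of the double-occupancy table, outer rows `7 ≤ i < 14` (slice 2 of 10). -/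
theorem card_r8s4_inter_slice1 : ∀ i j : Fin 70, 7 ≤ i.val → i.val < 14 → (r8s4 i ∩ r8s4 j).card = r8d44 i j := by
  decide +kernel

set_option maxRecDepth 100000 in set_option maxHeartbeats 4000000 in
/-- Kernel check of the double-occupancy table, outer rows `14 ≤ i < 21` (slice 3 of 10). -/
theorem card_r8s4_inter_slice2 : ∀ i j : Fin 70, 14 ≤ i.val → i.val < 21 → (r8s4 i ∩ r8s4 j).card = r8d44 i j := by
  decide +kernel

set_option maxRecDepth 100000 in set_option maxHeartbeats 4000000 in
/-- Kernel check of the double-occupancy table, outer rows `21 ≤ i < 28` (slice 4 of 10). -/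
theorem card_r8s4_inter_slice3 : ∀ i j : Fin 70, 21 ≤ i.val → i.val < 28 → (r8s4 i ∩ r8s4 j).card = r8d44 i j := by
  decide +kernel

set_option maxRecDepth 100000 in set_option maxHeartbeats 4000000 in
/-- Kernel check of the double-occupancy table, outer rows `28 ≤ i < 35` (slice 5 of 10). -/
theorem card_r8s4_inter_slice4 : ∀ i j : Fin 70, 28 ≤ i.val → i.val < 35 → (r8s4 i ∩ r8s4 j).card = r8d44 i j := by
  decide +kernel

set_option maxRecDepth 100000 in set_option maxHeartbeats 4000000 in
/-- Kernel check of the double-occupancy table, outer rows `35 ≤ i < 42` (slice 6 of 10). -/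
theorem card_r8s4_inter_slice5 : ∀ i j : Fin 70, 35 ≤ i.val → i.val < 42 → (r8s4 i ∩ r8s4 j).card = r8d44 i j := by
  decide +kernel

set_option maxRecDepth 100000 in set_option maxHeartbeats 4000000 in
/-- Kernel check of the double-occupancy table, outer rows `42 ≤ i < 49` (slice 7 of 10). -/
theorem card_r8s4_inter_slice6 : ∀ i j : Fin 70, 42 ≤ i.val → i.val < 49 → (r8s4 i ∩ r8s4 j).card = r8d44 i j := by
  decide +kernel

set_option maxRecDepth 100000 in set_option maxHeartbeats 4000000 in
/-- Kernel check of the double-occupancy table, outer rows `49 ≤ i < 56` (slice 8 of 10). -/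
theorem card_r8s4_inter_slice7 : ∀ i j : Fin 70, 49 ≤ i.val → i.val < 56 → (r8s4 i ∩ r8s4 j).card = r8d44 i j := by
  decide +kernel

set_option maxRecDepth 100000 in set_option maxHeartbeats 4000000 in
/-- Kernel check of the double-occupancy table, outer rows `56 ≤ i < 63` (slice 9 of 10). -/
theorem card_r8s4_inter_slice8 : ∀ i j : Fin 70, 56 ≤ i.val → i.val < 63 → (r8s4 i ∩ r8s4 j).card = r8d44 i j := by
  decide +kernel

set_option maxRecDepth 100000 in set_option maxHeartbeats 4000000 in
/-- Kernel check of the double-occupancy table, outer rows `63 ≤ i < 70` (slice 10 of 10). -/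
theorem card_r8s4_inter_slice9 : ∀ i j : Fin 70, 63 ≤ i.val → i.val < 70 → (r8s4 i ∩ r8s4 j).card = r8d44 i j := by
  decide +kernel

/-- The table `r8d44` (assembled from the 10 kernel-checked slices). -/
theorem card_r8s4_inter : ∀ i j : Fin 70, (r8s4 i ∩ r8s4 j).card = r8d44 i j := by
  intro i j
  rcases Nat.lt_or_ge i.val 7 with h0 | h0
  · exact card_r8s4_inter_slice0 i j h0
  rcases Nat.lt_or_ge i.val 14 with h1 | h1
  · exact card_r8s4_inter_slice1 i j h0 h1
  rcases Nat.lt_or_ge i.val 21 with h2 | h2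
  · exact card_r8s4_inter_slice2 i j h1 h2
  rcases Nat.lt_or_ge i.val 28 with h3 | h3
  · exact card_r8s4_inter_slice3 i j h2 h3
  rcases Nat.lt_or_ge i.val 35 with h4 | h4
  · exact card_r8s4_inter_slice4 i j h3 h4
  rcases Nat.lt_or_ge i.val 42 with h5 | h5
  · exact card_r8s4_inter_slice5 i j h4 h5
  rcases Nat.lt_or_ge i.val 49 with h6 | h6
  · exact card_r8s4_inter_slice6 i j h5 h6
  rcases Nat.lt_or_ge i.val 56 with h7 | h7
  · exact card_r8s4_inter_slice7 i j h6 h7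
  rcases Nat.lt_or_ge i.val 63 with h8 | h8
  · exact card_r8s4_inter_slice8 i j h7 h8
  exact card_r8s4_inter_slice9 i j h8 i.isLt

/-- `L = 8`, sector `(4,4)`: UPPER certificate from an integer trial array (sector dimension `4 900`). -/
theorem ringL8_upperCertificate_of_trial (U hi : ℚ) (v : Fin 70 → Fin 70 → ℤ) (hv : 0 < nsqZ v)
    (hle : ((hopZ r8K4 r8K4 v : ℤ) : ℚ) + U * ((dblZ r8d44 v : ℤ) : ℚ) ≤ hi * ((nsqZ v : ℤ) : ℚ)) :
    UpperCertificate (hubbardRingTV 8 1 U) 4 4 hi :=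
  hubbardRingTV_upperCertificate_of_trial isSubsetEnum_r8s4 isSubsetEnum_r8s4 hoppingMatrix_r8s4
    hoppingMatrix_r8s4 card_r8s4_inter U hi v hv hle

set_option maxRecDepth 100000 in set_option maxHeartbeats 4000000 in
/-- Kernel check of the adjacency lists against the table, rows `0 ≤ i < 7` (slice 1 of 10). -/
theorem r8K4adj_rep_slice0 : ∀ i i' : Fin 70, i.val < 7 → adjCoeff (r8K4adj i) i' = r8K4 i i' := by
  decide +kernel

set_option maxRecDepth 100000 in set_option maxHeartbeats 4000000 in
/-- Kernel check of the adjacency lists against the table, rows `7 ≤ i < 14` (slice 2 of 10). -/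
theorem r8K4adj_rep_slice1 : ∀ i i' : Fin 70, 7 ≤ i.val → i.val < 14 → adjCoeff (r8K4adj i) i' = r8K4 i i' := by
  decide +kernel

set_option maxRecDepth 100000 in set_option maxHeartbeats 4000000 in
/-- Kernel check of the adjacency lists against the table, rows `14 ≤ i < 21` (slice 3 of 10). -/
theorem r8K4adj_rep_slice2 : ∀ i i' : Fin 70, 14 ≤ i.val → i.val < 21 → adjCoeff (r8K4adj i) i' = r8K4 i i' := by
  decide +kernel

set_option maxRecDepth 100000 in set_option maxHeartbeats 4000000 in
/-- Kernel check of the adjacency lists against the table, rows `21 ≤ i < 28` (slice 4 of 10). -/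
theorem r8K4adj_rep_slice3 : ∀ i i' : Fin 70, 21 ≤ i.val → i.val < 28 → adjCoeff (r8K4adj i) i' = r8K4 i i' := by
  decide +kernel

set_option maxRecDepth 100000 in set_option maxHeartbeats 4000000 in
/-- Kernel check of the adjacency lists against the table, rows `28 ≤ i < 35` (slice 5 of 10). -/
theorem r8K4adj_rep_slice4 : ∀ i i' : Fin 70, 28 ≤ i.val → i.val < 35 → adjCoeff (r8K4adj i) i' = r8K4 i i' := by
  decide +kernel

set_option maxRecDepth 100000 in set_option maxHeartbeats 4000000 in
/-- Kernel check of the adjacency lists against the table, rows `35 ≤ i < 42` (slice 6 of 10). -/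
theorem r8K4adj_rep_slice5 : ∀ i i' : Fin 70, 35 ≤ i.val → i.val < 42 → adjCoeff (r8K4adj i) i' = r8K4 i i' := by
  decide +kernel

set_option maxRecDepth 100000 in set_option maxHeartbeats 4000000 in
/-- Kernel check of the adjacency lists against the table, rows `42 ≤ i < 49` (slice 7 of 10). -/
theorem r8K4adj_rep_slice6 : ∀ i i' : Fin 70, 42 ≤ i.val → i.val < 49 → adjCoeff (r8K4adj i) i' = r8K4 i i' := by
  decide +kernel

set_option maxRecDepth 100000 in set_option maxHeartbeats 4000000 in
/-- Kernel check of the adjacency lists against the table, rows `49 ≤ i < 56` (slice 8 of 10). -/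
theorem r8K4adj_rep_slice7 : ∀ i i' : Fin 70, 49 ≤ i.val → i.val < 56 → adjCoeff (r8K4adj i) i' = r8K4 i i' := by
  decide +kernel

set_option maxRecDepth 100000 in set_option maxHeartbeats 4000000 in
/-- Kernel check of the adjacency lists against the table, rows `56 ≤ i < 63` (slice 9 of 10). -/
theorem r8K4adj_rep_slice8 : ∀ i i' : Fin 70, 56 ≤ i.val → i.val < 63 → adjCoeff (r8K4adj i) i' = r8K4 i i' := by
  decide +kernel

set_option maxRecDepth 100000 in set_option maxHeartbeats 4000000 in
/-- Kernel check of the adjacency lists against the table, rows `63 ≤ i < 70` (slice 10 of 10). -/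
theorem r8K4adj_rep_slice9 : ∀ i i' : Fin 70, 63 ≤ i.val → i.val < 70 → adjCoeff (r8K4adj i) i' = r8K4 i i' := by
  decide +kernel

/-- The adjacency lists `r8K4adj` represent the table `r8K4` (assembled from the 10 kernel-checked slices). -/
theorem r8K4adj_rep' : ∀ i j : Fin 70, adjCoeff (r8K4adj i) j = r8K4 i j := by
  intro i j
  rcases Nat.lt_or_ge i.val 7 with h0 | h0
  · exact r8K4adj_rep_slice0 i j h0
  rcases Nat.lt_or_ge i.val 14 with h1 | h1
  · exact r8K4adj_rep_slice1 i j h0 h1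
  rcases Nat.lt_or_ge i.val 21 with h2 | h2
  · exact r8K4adj_rep_slice2 i j h1 h2
  rcases Nat.lt_or_ge i.val 28 with h3 | h3
  · exact r8K4adj_rep_slice3 i j h2 h3
  rcases Nat.lt_or_ge i.val 35 with h4 | h4
  · exact r8K4adj_rep_slice4 i j h3 h4
  rcases Nat.lt_or_ge i.val 42 with h5 | h5
  · exact r8K4adj_rep_slice5 i j h4 h5
  rcases Nat.lt_or_ge i.val 49 with h6 | h6
  · exact r8K4adj_rep_slice6 i j h5 h6
  rcases Nat.lt_or_ge i.val 56 with h7 | h7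
  · exact r8K4adj_rep_slice7 i j h6 h7
  rcases Nat.lt_or_ge i.val 63 with h8 | h8
  · exact r8K4adj_rep_slice8 i j h7 h8
  exact r8K4adj_rep_slice9 i j h8 i.isLt

/-- `AdjRep r8K4adj r8K4`. -/
theorem r8K4adj_rep : AdjRep r8K4adj r8K4 := r8K4adj_rep'

/-- `hopZ` of a `70 × 70` array as the sum of 10 row slices of 7 (slice-wise kernel evaluation). -/
theorem hopZ_r8K4_adjSlices (v : Fin 70 → Fin 70 → ℤ) :
    hopZ r8K4 r8K4 v = hopZAdjSlices r8K4adj r8K4adj v 0 7 + hopZAdjSlices r8K4adj r8K4adj v 7 7 + hopZAdjSlices r8K4adj r8K4adj v 14 7 + hopZAdjSlices r8K4adj r8K4adj v 21 7 + hopZAdjSlices r8K4adj r8K4adj v 28 7 + hopZAdjSlices r8K4adj r8K4adj v 35 7 + hopZAdjSlices r8K4adj r8K4adj v 42 7 + hopZAdjSlices r8K4adj r8K4adj v 49 7 + hopZAdjSlices r8K4adj r8K4adj v 56 7 + hopZAdjSlices r8K4adj r8K4adj v 63 7 := by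
  rw [hopZ_eq_hopZAdjSlices r8K4adj_rep r8K4adj_rep v]
  have e : ∀ lo a b n m : ℕ, a + b = n → lo + a = m →
      hopZAdjSlices r8K4adj r8K4adj v lo n = hopZAdjSlices r8K4adj r8K4adj v lo a + hopZAdjSlices r8K4adj r8K4adj v m b := by
    rintro lo a b n m rfl rfl; exact hopZAdjSlices_add _ _ v lo a b
  rw [e 0 7 63 70 7 rfl rfl]
  rw [e 7 7 56 63 14 rfl rfl]
  rw [e 14 7 49 56 21 rfl rfl]
  rw [e 21 7 42 49 28 rfl rfl]
  rw [e 28 7 35 42 35 rfl rfl]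
  rw [e 35 7 28 35 42 rfl rfl]
  rw [e 42 7 21 28 49 rfl rfl]
  rw [e 49 7 14 21 56 rfl rfl]
  rw [e 56 7 7 14 63 rfl rfl]
  simp only [add_assoc]

/-- `dblZ` of a `70 × 70` array as the sum of 10 row slices of 7 (slice-wise kernel evaluation). -/
theorem dblZ_r8d44_slices (v : Fin 70 → Fin 70 → ℤ) :
    dblZ r8d44 v = dblZSlices r8d44 v 0 7 + dblZSlices r8d44 v 7 7 + dblZSlices r8d44 v 14 7 + dblZSlices r8d44 v 21 7 + dblZSlices r8d44 v 28 7 + dblZSlices r8d44 v 35 7 + dblZSlices r8d44 v 42 7 + dblZSlices r8d44 v 49 7 + dblZSlices r8d44 v 56 7 + dblZSlices r8d44 v 63 7 := by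
  rw [dblZ_eq_dblZSlices r8d44 v]
  have e : ∀ lo a b n m : ℕ, a + b = n → lo + a = m →
      dblZSlices r8d44 v lo n = dblZSlices r8d44 v lo a + dblZSlices r8d44 v m b := by
    rintro lo a b n m rfl rfl; exact dblZSlices_add _ v lo a b
  rw [e 0 7 63 70 7 rfl rfl]
  rw [e 7 7 56 63 14 rfl rfl]
  rw [e 14 7 49 56 21 rfl rfl]
  rw [e 21 7 42 49 28 rfl rfl]
  rw [e 28 7 35 42 35 rfl rfl]
  rw [e 35 7 28 35 42 rfl rfl]
  rw [e 42 7 21 28 49 rfl rfl]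
  rw [e 49 7 14 21 56 rfl rfl]
  rw [e 56 7 7 14 63 rfl rfl]
  simp only [add_assoc]

/-- `nsqZ` of a `70 × 70` array as the sum of 10 row slices of 7 (slice-wise kernel evaluation). -/
theorem nsqZ_r8_slices (v : Fin 70 → Fin 70 → ℤ) :
    nsqZ v = nsqZSlices v 0 7 + nsqZSlices v 7 7 + nsqZSlices v 14 7 + nsqZSlices v 21 7 + nsqZSlices v 28 7 + nsqZSlices v 35 7 + nsqZSlices v 42 7 + nsqZSlices v 49 7 + nsqZSlices v 56 7 + nsqZSlices v 63 7 := by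
  rw [nsqZ_eq_nsqZSlices v]
  have e : ∀ lo a b n m : ℕ, a + b = n → lo + a = m →
      nsqZSlices v lo n = nsqZSlices v lo a + nsqZSlices v m b := by
    rintro lo a b n m rfl rfl; exact nsqZSlices_add v lo a b
  rw [e 0 7 63 70 7 rfl rfl]
  rw [e 7 7 56 63 14 rfl rfl]
  rw [e 14 7 49 56 21 rfl rfl]
  rw [e 21 7 42 49 28 rfl rfl]
  rw [e 28 7 35 42 35 rfl rfl]
  rw [e 35 7 28 35 42 rfl rfl]
  rw [e 42 7 21 28 49 rfl rfl]
  rw [e 49 7 14 21 56 rfl rfl]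
  rw [e 56 7 7 14 63 rfl rfl]
  simp only [add_assoc]

end L8

end Summit.Ventures.CertifiedQuantumChemistry
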